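/-
Copyright (c) 2026 the pub-hodgecm-mathlib formalisation cell (harness21).  Prover seat hodgecm-mathlib-K2E2-p12 (g9), Track B «K2-LIT», h413 = `stmt-HodgeConjecture-24833`,
R90-TF section S8 «ContSpec-n½», deal S8-R97∕R98∕R105 payer (a) (S8 dealer R90-CS-plan (g2); successor brief `K2/K2E2-p12/g8/CENSUS-TubeSeedPair.md`): the χ-PAIR TUBE SEED at
`U(2,1)_{L/L⁺}` — the `N = 3` LEVEL twin of ★ `K2E1TruncatedEisensteinCuspOrthogonalLevelCMTwo` §1 and the PAIR-section twin of ★ `K2E1TruncatedEisensteinCuspOrthogonalCMThree`.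
-/
import Summits.HodgeConjecture.HodgeConjecture.Theorems.K2E1TruncatedEisensteinCuspOrthogonalCMThree     -- ★ 3a₃ (K2E4-p10): `exists_tsum_enorm_lowIndicator_le_cm_three` (the majorant at the constant section); brings ★ FILE A∕B at `N = 3`, (β1), `siegel_three`, ★ `truncation_eisensteinSeriesU_eq_three`, Godement CM₃, ★ (ν-2) `K2E1HeisenbergHaarU3`
import Summits.HodgeConjecture.HodgeConjecture.Theorems.K2E1TruncatedEisensteinBoundedCMThree             -- ★ `eisensteinSeriesU_flatSectionU_arithmeticSubgroup_mul`, ★ `measurable_borelConstantTerm` (N-generic §1), ★ R4a₃ `continuous_eisensteinSeriesU_flatSectionU_cm_three`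
import Summits.HodgeConjecture.HodgeConjecture.Theorems.K2E1CharacterEisensteinU3PairDefs              -- ★ p861816 D-S8-3: `IsChiSectionPair` (+ `.unipotent_mul`, `.toAdelic_mul`); members of ★ `chiSectionSpacePair χ₁ χ₂ K′ ω` enter via ★ `isChiSectionPair_of_mem`
import Literature.NumberTheory.Automorphic.UnitaryGroupBorelConstantTermInvariance                       -- ★ `borelConstantTerm_rational_borel_mul_of_rational_invariant` (`E_B` is left-`B(L⁺)`-invariant)
import Literature.NumberTheory.Automorphic.UnitaryGroupUnipotentUnimodularThree                          -- ★ `borelConstantTerm_unipotent_mul_of_isMulRightInvariant` (`E_B` is left-`N(𝔸)`-invariant)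
import HarnessLib

/-!
# K2·E1 ∕ R90·S8 — `K2E1ChiEisensteinPairTubeSeedCuspOrthogonalCMThree` (S8-R97 payer (a), THE χ-PAIR TUBE SEED, `U(2,1)_{L/L⁺}`):
# **`⟪φ̂, [Λ^T E(φ_ξ H^z)]⟫ = 0` FOR EVERY CUSP FORM `φ`, `2 < Re z`, `T ≥ 1` — FOR A LEVEL SECTION, FOR A `(χ₁, χ₂)`-PAIR SECTION, AND IN THE `hseed` SHAPE OF THE (R)-ROAD**

Cell `pub/hodgecm-mathlib`, crux h413 = `stmt-HodgeConjecture-24833`, route of record `HCCMUnconditional`; R90-TF section S8 «ContSpec-n½», socket #2∕#3 via B ED. 5's sub-socket (R), the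
`(L²_cusp)ᗮ` half «OF LETTERS» ★ `R90S8ResGMidAtomOrthogonalCuspidalU3` (K2E1-p12 (g4)), whose per-generator letter (a) is `hseed : ∀ z ∈ D, 2 < z.re → ∀ φ, ⟪cuspFormsToLp μ 𝔓 φ, F z⟫ = 0`
for the operator road's truncated family `F z =ᵐ Λ^T Ẽ(z)` of a PAIR section `φ_ξ` of the `φ_ξ`-block.  THEOREMS ONLY (no `def`, no `instance`, no notation, no named-fact hypothesis, no
`sorry`; default heartbeats); lane `--supports stmt-HodgeConjecture-24833 --as helper` (count-neutral).  Closes no socket.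

THE MATHEMATICS ([MoeglinWaldspurger1995, IV.1.11 with II.1.7–II.1.8 and I.2.13]; [BernsteinLapid2019, §4 Claim 2]).  ★ 3a₃ treats the CONSTANT section `fun _ => φ₀` at `N = 3`, ★
`…LevelCMTwo` §1 a general bounded continuous left-`N(𝔸)`∕`B(L⁺)`-invariant section at `N = 2`; here the two are merged at `N = 3`.  On the Godement tube `2 < Re z` the truncated
Eisenstein series of `f_z = φ₁H^z` splits POINTWISE as `Λ^T E(f_z) = E(𝟙_{H≤T} f_z) − E(𝟙_{H>T} Mf)` with the TAIL `Mf := E_B(E(f_z)) − f_z` (★ `truncation_eisensteinSeriesU_eq_three`; `Mf`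
is left-`B(L⁺)`-invariant by ★ `borelConstantTerm_rational_borel_mul_of_rational_invariant`, left-`N(𝔸)`-invariant by ★ `borelConstantTerm_unipotent_mul_of_isMulRightInvariant` — the
`U(3)` Heisenberg radical is unimodular, ★ (ν-2) — and Borel by ★ `measurable_borelConstantTerm`); both pieces are Eisenstein series of Borel left-`N(𝔸)B(L⁺)`-invariant functions, so ★
FILE A («`E(f) ⊥ Λ` when `Λ_B ≡ 0`», `K2E1BLEisensteinCuspOrthogonalU`) applies twice against the lift `Λ = invQuot φ` of a cusp form (★ (β1)); its `L¹` letters: (i′) for the tail ONE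
visible letter `hMbd : ‖E_B(E(f_z))(g) − f_z(g)‖ ≤ C` on `{T < H}` ([MoeglinWaldspurger1995] II.1.7: `E_B(E f_z) − f_z = M(w,z)f_z`, `|M(w,z)f_z(g)| ≤ M·c(Re z)·H(g)^{2−Re z} ≤ M·c(Re z)`
above the floor; its `N = 2` payer is ★ `K2E1EisensteinConstantTermIntertwinedBoundLevelU2`, the `N = 3` twin is not ★ tonight — kept visible) and one coset above the floor (★
`tsum_enorm_indicator_lt_le siegel_three`); (ii′) for the low part DOMINATION by the constant section `fun _ => (M : ℂ)` (`‖φ₁‖ ≤ M`), so ★ `exists_tsum_enorm_lowIndicator_le_cm_three` applies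
verbatim and the (Tr) letter is the SPHERICAL `Λ^T E((M:ℂ)H^{Re z}) ∈ L²(μ)` + Hölder against `φ ∈ L²`; (iii′) the Godement majorant ★ `summable_eisensteinSeriesU_flatSectionU_cm_three` at
`(φ := φ₁) (M := M)`.  A `(χ₁, χ₂)`-pair section (★ `IsChiSectionPair`, `χ₂` automorphic) IS such a level section (★ `.unipotent_mul`, ★ `.toAdelic_mul`).
* §1 **`inner_cuspFormsToLp_eq_zero_of_ae_eq_truncation_level_cm_three`** — `⟪φ̂, v⟫ = 0` for every `L²` class `v =ᵐ Λ^T E(φ₁H^z)`, `2 < Re z`, any LEVEL section `φ₁`.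
* §2 **`inner_cuspFormsToLp_eq_zero_of_ae_eq_truncation_pair_cm_three`** — the same for a `(χ₁, χ₂)`-PAIR section `φ_ξ` (`χ₂` automorphic): THE χ-PAIR TUBE SEED, per point
  (members of ★ `chiSectionSpacePair χ₁ χ₂ K′ ω` enter via ★ `isChiSectionPair_of_mem`).
* §3 **`tubeSeed_level_cm_three_of_letters`**, **`tubeSeed_pair_cm_three_of_letters`** — the letter (a) of ★ `inner_cuspFormsToLp_eq_zero_of_midResidue_letters` ∕
  `resGMidAtomGen_inner_cuspidal_eq_zero_of_letters` TOKEN FOR TOKEN: `∀ z ∈ D, 2 < z.re → ∀ φ, ⟪cuspFormsToLp μ 𝔓 φ, Fam z⟫ = 0` for the operator road's `Fam z =ᵐ Λ^T(Ec z)`, `Ec z =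
  E(φ₁H^z)` on `D ∩ {2 < Re}`, the tail letter `hMbd` quantified over the tube points of `D` and the spherical (Tr) letter `hTr` at every real `σ > 2`.
HONEST LABEL: HC_CM is proved only modulo the 7 printed citations (2 remaining named inputs: hLiu418 = `stmt-HodgeConjecture-24832`, h413 = `stmt-HodgeConjecture-24833`) until rung 0
closes; this file asserts no named fact and closes no socket; its heads are CONDITIONAL on the visible letters `hMbd` (tail bound, [MoeglinWaldspurger1995] II.1.7), `hL2`∕`hTr` (spherical
(Tr)), and in §3 `(Ec, hE2)`, `(Fam, hFam)`; count-neutral.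
References: [MoeglinWaldspurger1995] I.2.13, I.2.17, II.1.7–II.1.8, IV.1.11 · [BernsteinLapid2019] §4 p. 10 · [Rogawski1990] §13.9 p. 229 · [Garrett2018] §2.10–§2.11 · [BorelJacquet1979] §4.4–§4.6.
-/

set_option autoImplicit false
set_option linter.dupNamespace false  -- the mandated namespace repeats the single-problem summit's segment (`HodgeConjecture.HodgeConjecture`)

noncomputable section

open MeasureTheory Measure NumberField IsDedekindDomain Set Filter Topology MulAction
open scoped ENNReal NNReal InnerProductSpace ComplexConjugate
open Literature.MeasureTheory.Group Literature.NumberTheory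
open Literature.NumberTheory.Automorphic Literature.NumberTheory.Automorphic.UnitaryGroup AdelicGroupData
open Literature.NumberTheory.Automorphic.Arthur2013.Leaves.TECR
open Literature.NumberTheory.GaloisRepresentations (HeckeCharacter)
open Summit.HodgeConjecture.HodgeConjecture.Cruxes.H413.K2E1BorelEisensteinU
open Summit.HodgeConjecture.HodgeConjecture.Cruxes.H413.K2E1BorelCosetsDictionary (eisensteinSeriesU_eq_tsum_arithmeticBorelQuot forall_arithmeticBorel_iff)
open Summit.HodgeConjecture.HodgeConjecture.Cruxes.H413.K2E1TruncatedEisensteinExplicit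
open Summit.HodgeConjecture.HodgeConjecture.Cruxes.H413.K2E1MaassSelbergBracketsThree (measurable_flatSectionU)
open Summit.HodgeConjecture.HodgeConjecture.Cruxes.H413.K2E1BLEisensteinCuspOrthogonalU
open Summit.HodgeConjecture.HodgeConjecture.Cruxes.H413.K2E1BLEisensteinInWeightedSpaceU2 (lintegral_weight_enorm_mul_lt_top_of_lintegral_quotient_lt_top exists_isCoveringWeight_arithmeticBorel)
open Summit.HodgeConjecture.HodgeConjecture.Cruxes.H413.K2E1CuspConditionDictionaryU (invQuot_package_of_mem_cuspForms)
open Summit.HodgeConjecture.HodgeConjecture.Cruxes.H413.K2E1BorelEisensteinGodementCMThree (summable_eisensteinSeriesU_flatSectionU_cm_three)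
open Summit.HodgeConjecture.HodgeConjecture.Cruxes.H413.K2E1SphericalHeckeEigenSectionU2 (norm_borelHeight_cpow continuous_borelHeight_cpow borelHeight_coe_pos)
open Summit.HodgeConjecture.HodgeConjecture.Cruxes.H413.K2E1BLBorelSpacesU2Defs
open Summit.HodgeConjecture.HodgeConjecture.Cruxes.H413.K2E1SphericalEisensteinResidueOrthogonalU
open Summit.HodgeConjecture.HodgeConjecture.Cruxes.H413.K2E1TruncatedEisensteinCuspOrthogonalCMThree (exists_tsum_enorm_lowIndicator_le_cm_three)
open Summit.HodgeConjecture.HodgeConjecture.Cruxes.H413.K2E1TruncatedEisensteinBoundedCMThree (eisensteinSeriesU_flatSectionU_arithmeticSubgroup_mul measurable_borelConstantTerm)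
open Summit.HodgeConjecture.HodgeConjecture.Cruxes.H413.K2E1BorelEisensteinRegularCMThree (continuous_eisensteinSeriesU_flatSectionU_cm_three)
open Summit.HodgeConjecture.HodgeConjecture.Cruxes.H413.K2E1CharacterEisensteinU3PairDefs

namespace Summit.HodgeConjecture.HodgeConjecture.Cruxes.H413.K2E1ChiEisensteinPairTubeSeedCuspOrthogonalCMThree

variable (L : Type) [Field L] [NumberField L] [IsCMField L]
variable [MeasurableSpace (quasiSplit (↥(maximalRealSubfield L)) L (IsCMField.complexConj L) 3).Adelic] [BorelSpace (quasiSplit (↥(maximalRealSubfield L)) L (IsCMField.complexConj L) 3).Adelic]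
variable (μ : Measure (quasiSplit (↥(maximalRealSubfield L)) L (IsCMField.complexConj L) 3).automorphicQuotient) [(quasiSplit (↥(maximalRealSubfield L)) L (IsCMField.complexConj L) 3).IsAutomorphicMeasure μ]

/-! ## §1 On the tube: `⟪φ̂, [Λ^T E(φ₁H^z)]⟫ = 0` for every cusp form `φ` and every LEVEL section `φ₁` of `U(2,1)` -/

section Level
/-- **`⟪φ̂, v⟫ = 0` ON THE TUBE, LEVEL SECTION, `U(2,1)`**: `2 < Re z`, `T ≥ 1`, `ν` Haar on `N(𝔸)` with a fundamental domain `𝓕` of compact closure, `𝔓.radical i = N(𝔸)`, `φ₁` a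
CONTINUOUS BOUNDED left-`N(𝔸)`∕`B(L⁺)`-invariant section, `φ ∈ cuspForms μ 𝔓`, `v =ᵐ Λ^T E(φ₁H^z)` in `L²(μ)` — under the SPHERICAL (Tr) letter `Λ^T E((M:ℂ)H^{Re z}) ∈ L²(μ)` and the
TAIL LETTER `‖E_B(E(φ₁H^z))(g) − φ₁(g)H(g)^z‖ ≤ C` on `{T < H}`: the split ★ `truncation_eisensteinSeriesU_eq_three` with `Mf := E_B(E f_z) − f_z`, ★ FILE A twice against `Λ = invQuot φ`
(`Λ_B ≡ 0`), `hL1` by ★ FILE B + Hölder. [cite: MoeglinWaldspurger1995, II.1.7–II.1.8, IV.1.11] [cite: BernsteinLapid2019, §4 Claim 2] -/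
theorem inner_cuspFormsToLp_eq_zero_of_ae_eq_truncation_level_cm_three
    (ν : Measure ↥(adelicUnipotent (↥(maximalRealSubfield L)) L (IsCMField.complexConj L) 3)) [ν.IsHaarMeasure]
    {𝓕 : Set ↥(adelicUnipotent (↥(maximalRealSubfield L)) L (IsCMField.complexConj L) 3)}
    (h𝓕N : IsFundamentalDomain ↥(rationalUnipotent (↥(maximalRealSubfield L)) L (IsCMField.complexConj L) 3) 𝓕 ν) (h𝓕c : IsCompact (closure 𝓕))
    (𝔓 : (quasiSplit (↥(maximalRealSubfield L)) L (IsCMField.complexConj L) 3).ParabolicUnipotentData) (i : 𝔓.ι)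
    (h𝔓 : 𝔓.radical i = adelicUnipotent (↥(maximalRealSubfield L)) L (IsCMField.complexConj L) 3)
    {φ₁ : (quasiSplit (↥(maximalRealSubfield L)) L (IsCMField.complexConj L) 3).Adelic → ℂ} (hφc : Continuous φ₁) {M : ℝ} (hφM : ∀ x, ‖φ₁ x‖ ≤ M)
    (hφN : ∀ (u : ↥(adelicUnipotent (↥(maximalRealSubfield L)) L (IsCMField.complexConj L) 3)) (x : (quasiSplit (↥(maximalRealSubfield L)) L (IsCMField.complexConj L) 3).Adelic),
      φ₁ ((u : (quasiSplit (↥(maximalRealSubfield L)) L (IsCMField.complexConj L) 3).Adelic) * x) = φ₁ x)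
    (hφB : ∀ b ∈ borelU ((IsCMField.complexConj L : L ≃ₐ[↥(maximalRealSubfield L)] L) : L →+* L) ((StdForm.antidiagonal 3).over L),
      ∀ x : (quasiSplit (↥(maximalRealSubfield L)) L (IsCMField.complexConj L) 3).Adelic,
        φ₁ ((quasiSplit (↥(maximalRealSubfield L)) L (IsCMField.complexConj L) 3).toAdelic b * x) = φ₁ x)
    {T : ℝ≥0} (hT : 1 ≤ T) {z : ℂ} (hz : 2 < z.re)
    {C : ℝ} (hMbd : ∀ g : (quasiSplit (↥(maximalRealSubfield L)) L (IsCMField.complexConj L) 3).Adelic, T < borelHeight g →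
      ‖borelConstantTerm ν 𝓕 (eisensteinSeriesU (flatSectionU φ₁ z)) g - flatSectionU φ₁ z g‖ ≤ C)
    (v : (quasiSplit (↥(maximalRealSubfield L)) L (IsCMField.complexConj L) 3).L2 μ)
    (hv : (v : (quasiSplit (↥(maximalRealSubfield L)) L (IsCMField.complexConj L) 3).automorphicQuotient → ℂ) =ᵐ[μ]
      (quasiSplit (↥(maximalRealSubfield L)) L (IsCMField.complexConj L) 3).quotFun (truncation ν 𝓕 T (eisensteinSeriesU (flatSectionU φ₁ z))))
    (hL2 : MemLp ((quasiSplit (↥(maximalRealSubfield L)) L (IsCMField.complexConj L) 3).quotFun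
      (truncation ν 𝓕 T (eisensteinSeriesU (flatSectionU (fun _ : (quasiSplit (↥(maximalRealSubfield L)) L (IsCMField.complexConj L) 3).Adelic => ((M : ℝ) : ℂ)) ((z.re : ℝ) : ℂ))))) 2 μ)
    (φ : ↥((quasiSplit (↥(maximalRealSubfield L)) L (IsCMField.complexConj L) 3).cuspForms μ 𝔓)) :
    ⟪(quasiSplit (↥(maximalRealSubfield L)) L (IsCMField.complexConj L) 3).cuspFormsToLp μ 𝔓 φ, v⟫_ℂ = 0 := by
  haveI := t2Space_adeleRing_of_numberField L
  haveI := locallyCompactSpace_adeleRing' L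
  haveI := secondCountableTopology_adeleRing L
  haveI : T2Space (quasiSplit (↥(maximalRealSubfield L)) L (IsCMField.complexConj L) 3).Adelic :=
    inferInstanceAs (T2Space (adelic (↥(maximalRealSubfield L)) L (IsCMField.complexConj L) 3 ((StdForm.antidiagonal 3).over L)))
  haveI : LocallyCompactSpace (quasiSplit (↥(maximalRealSubfield L)) L (IsCMField.complexConj L) 3).Adelic :=
    inferInstanceAs (LocallyCompactSpace (adelic (↥(maximalRealSubfield L)) L (IsCMField.complexConj L) 3 ((StdForm.antidiagonal 3).over L)))
  haveI : SecondCountableTopology (quasiSplit (↥(maximalRealSubfield L)) L (IsCMField.complexConj L) 3).Adelic :=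
    inferInstanceAs (SecondCountableTopology (adelic (↥(maximalRealSubfield L)) L (IsCMField.complexConj L) 3 ((StdForm.antidiagonal 3).over L)))
  have hc : (IsCMField.complexConj L) * (IsCMField.complexConj L) = 1 := AlgEquiv.ext fun x => IsCMField.complexConj_apply_apply L x
  have hc1 : (IsCMField.complexConj L) ≠ 1 := IsCMField.complexConj_ne_one L
  haveI : (haar : Measure (quasiSplit (↥(maximalRealSubfield L)) L (IsCMField.complexConj L) 3).Adelic).IsMulRightInvariant :=
    forall_isHaarMeasure_isMulRightInvariant_quasiSplit_cm L (by norm_num : 2 ≤ 3) haar inferInstance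
  haveI : (haar : Measure (quasiSplit (↥(maximalRealSubfield L)) L (IsCMField.complexConj L) 3).Adelic).IsInvInvariant := isInvInvariant_of_isMulRightInvariant _
  haveI : ν.IsInvInvariant := K2E1HeisenbergHaarU3.isInvInvariant_of_isHaarMeasure_adelicUnipotent_three hc ν
  have h𝓕₀ : ν 𝓕 ≠ 0 := measure_ne_zero_of_isFundamentalDomain_rationalUnipotent ν h𝓕N
  haveI : ν.IsMulRightInvariant := by
    have h := Measure.inv.instIsMulRightInvariant (μ := ν)
    rwa [Measure.inv_eq_self] at h
  have h𝓕top : ν 𝓕 ≠ ∞ := ((measure_mono subset_closure).trans_lt h𝓕c.measure_lt_top).ne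
  obtain ⟨β, hβ⟩ := exists_isCoveringWeight_arithmeticBorel (F := (↥(maximalRealSubfield L))) (E := L) (c := (IsCMField.complexConj L)) (N := 3)
  -- the section, the TAIL `Mf := E_B(E f_z) − f_z`, the low and high pieces
  set f : (quasiSplit (↥(maximalRealSubfield L)) L (IsCMField.complexConj L) 3).Adelic → ℂ := flatSectionU φ₁ z with hf
  set Mf : (quasiSplit (↥(maximalRealSubfield L)) L (IsCMField.complexConj L) 3).Adelic → ℂ := fun g => borelConstantTerm ν 𝓕 (eisensteinSeriesU f) g - f g with hMf
  set f₁ : (quasiSplit (↥(maximalRealSubfield L)) L (IsCMField.complexConj L) 3).Adelic → ℂ :=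
    {g : (quasiSplit (↥(maximalRealSubfield L)) L (IsCMField.complexConj L) 3).Adelic | borelHeight g ≤ T}.indicator f with hf₁
  set f₂ : (quasiSplit (↥(maximalRealSubfield L)) L (IsCMField.complexConj L) 3).Adelic → ℂ :=
    {g : (quasiSplit (↥(maximalRealSubfield L)) L (IsCMField.complexConj L) 3).Adelic | T < borelHeight g}.indicator Mf with hf₂
  have hφB' : ∀ b ∈ arithmeticBorel (↥(maximalRealSubfield L)) L (IsCMField.complexConj L) 3, ∀ x : (quasiSplit (↥(maximalRealSubfield L)) L (IsCMField.complexConj L) 3).Adelic,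
      φ₁ ((b : (quasiSplit (↥(maximalRealSubfield L)) L (IsCMField.complexConj L) 3).Adelic) * x) = φ₁ x := forall_arithmeticBorel_iff.2 hφB
  have hfB : ∀ b ∈ arithmeticBorel (↥(maximalRealSubfield L)) L (IsCMField.complexConj L) 3, ∀ x : (quasiSplit (↥(maximalRealSubfield L)) L (IsCMField.complexConj L) 3).Adelic,
      f ((b : (quasiSplit (↥(maximalRealSubfield L)) L (IsCMField.complexConj L) 3).Adelic) * x) = f x := fun b hb x => by
    simp only [hf, flatSectionU_apply, K2E1TruncatedEisensteinExplicit.borelHeight_arithmeticBorel_mul hb, hφB' b hb x]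
  have hEG : ∀ (γ : (quasiSplit (↥(maximalRealSubfield L)) L (IsCMField.complexConj L) 3).arithmeticSubgroup) (x : (quasiSplit (↥(maximalRealSubfield L)) L (IsCMField.complexConj L) 3).Adelic),
      eisensteinSeriesU f ((γ : (quasiSplit (↥(maximalRealSubfield L)) L (IsCMField.complexConj L) 3).Adelic) * x) = eisensteinSeriesU f x := fun γ x => eisensteinSeriesU_flatSectionU_arithmeticSubgroup_mul hφB z γ x
  have hCTB : ∀ b ∈ arithmeticBorel (↥(maximalRealSubfield L)) L (IsCMField.complexConj L) 3, ∀ x : (quasiSplit (↥(maximalRealSubfield L)) L (IsCMField.complexConj L) 3).Adelic,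
      borelConstantTerm ν 𝓕 (eisensteinSeriesU f) ((b : (quasiSplit (↥(maximalRealSubfield L)) L (IsCMField.complexConj L) 3).Adelic) * x) = borelConstantTerm ν 𝓕 (eisensteinSeriesU f) x := fun b hb x =>
    borelConstantTerm_rational_borel_mul_of_rational_invariant ν h𝓕N hEG b hb x
  have hEN : ∀ u : ↥(adelicUnipotent (↥(maximalRealSubfield L)) L (IsCMField.complexConj L) 3), u ∈ rationalUnipotent (↥(maximalRealSubfield L)) L (IsCMField.complexConj L) 3 →
      ∀ x : (quasiSplit (↥(maximalRealSubfield L)) L (IsCMField.complexConj L) 3).Adelic, eisensteinSeriesU f ((u : (quasiSplit (↥(maximalRealSubfield L)) L (IsCMField.complexConj L) 3).Adelic) * x) = eisensteinSeriesU f x := fun u hu x => by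
    obtain ⟨γ, hγ⟩ := (mem_rationalUnipotent_iff u).1 hu
    rw [← hγ]
    exact eisensteinSeriesU_flatSectionU_rational_mul hφB z γ x
  have hCTN : ∀ (u : ↥(adelicUnipotent (↥(maximalRealSubfield L)) L (IsCMField.complexConj L) 3)) (g : (quasiSplit (↥(maximalRealSubfield L)) L (IsCMField.complexConj L) 3).Adelic),
      borelConstantTerm ν 𝓕 (eisensteinSeriesU f) ((u : (quasiSplit (↥(maximalRealSubfield L)) L (IsCMField.complexConj L) 3).Adelic) * g) = borelConstantTerm ν 𝓕 (eisensteinSeriesU f) g := fun u g =>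
    borelConstantTerm_unipotent_mul_of_isMulRightInvariant ν h𝓕N hEN u g
  have hfN : ∀ (u : ↥(adelicUnipotent (↥(maximalRealSubfield L)) L (IsCMField.complexConj L) 3)) (g : (quasiSplit (↥(maximalRealSubfield L)) L (IsCMField.complexConj L) 3).Adelic), f ((u : (quasiSplit (↥(maximalRealSubfield L)) L (IsCMField.complexConj L) 3).Adelic) * g) = f g := fun u g => by
    simp only [hf, flatSectionU_apply, hφN u g, borelHeight_unipotent_mul u.2]
  have hMfB : ∀ b ∈ arithmeticBorel (↥(maximalRealSubfield L)) L (IsCMField.complexConj L) 3, ∀ x : (quasiSplit (↥(maximalRealSubfield L)) L (IsCMField.complexConj L) 3).Adelic,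
      Mf ((b : (quasiSplit (↥(maximalRealSubfield L)) L (IsCMField.complexConj L) 3).Adelic) * x) = Mf x := fun b hb x => by
    show borelConstantTerm ν 𝓕 (eisensteinSeriesU f) ((b : (quasiSplit (↥(maximalRealSubfield L)) L (IsCMField.complexConj L) 3).Adelic) * x) - f ((b : (quasiSplit (↥(maximalRealSubfield L)) L (IsCMField.complexConj L) 3).Adelic) * x) = borelConstantTerm ν 𝓕 (eisensteinSeriesU f) x - f x
    rw [hCTB b hb x, hfB b hb x]
  have hMfN : ∀ (u : ↥(adelicUnipotent (↥(maximalRealSubfield L)) L (IsCMField.complexConj L) 3)) (g : (quasiSplit (↥(maximalRealSubfield L)) L (IsCMField.complexConj L) 3).Adelic), Mf ((u : (quasiSplit (↥(maximalRealSubfield L)) L (IsCMField.complexConj L) 3).Adelic) * g) = Mf g := fun u g => by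
    show borelConstantTerm ν 𝓕 (eisensteinSeriesU f) ((u : (quasiSplit (↥(maximalRealSubfield L)) L (IsCMField.complexConj L) 3).Adelic) * g) - f ((u : (quasiSplit (↥(maximalRealSubfield L)) L (IsCMField.complexConj L) 3).Adelic) * g) = borelConstantTerm ν 𝓕 (eisensteinSeriesU f) g - f g
    rw [hCTN u g, hfN u g]
  have hf₁B := forall_arithmeticBorel_indicator hfB fun h => h ≤ T
  have hf₂B := forall_arithmeticBorel_indicator hMfB fun h => T < h
  have hCT : ∀ x : (quasiSplit (↥(maximalRealSubfield L)) L (IsCMField.complexConj L) 3).Adelic, T < borelHeight x →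
      borelConstantTerm ν 𝓕 (eisensteinSeriesU f) x = f x + Mf x := fun x _ => (add_sub_cancel (f x) _).symm
  -- measurability (`E(f_z)` is continuous, ★ R4a₃; `E_B` of a Borel function is Borel, ★) and `N(𝔸)`-invariance of the pieces
  have hfm : Measurable f := measurable_flatSectionU hφc.measurable _
  have hEm : Measurable (eisensteinSeriesU f) := (continuous_eisensteinSeriesU_flatSectionU_cm_three L hz hφc hφM).measurable
  haveI : SecondCountableTopology ↥(adelicUnipotent (↥(maximalRealSubfield L)) L (IsCMField.complexConj L) 3) := TopologicalSpace.Subtype.secondCountableTopology _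
  have hNcl : IsClosed ((adelicUnipotent (↥(maximalRealSubfield L)) L (IsCMField.complexConj L) 3 :
      Set (quasiSplit (↥(maximalRealSubfield L)) L (IsCMField.complexConj L) 3).Adelic)) := by
    change IsClosed (⇑(adelicVal (↥(maximalRealSubfield L)) L (IsCMField.complexConj L) 3 ((StdForm.antidiagonal 3).over L)) ⁻¹'
      ((upperUnitriangular (Fin 3) (AdeleRing (𝓞 L) L) : Subgroup (GL (Fin 3) (AdeleRing (𝓞 L) L))) : Set (GL (Fin 3) (AdeleRing (𝓞 L) L))))
    exact (isClosed_upperUnitriangular (R := AdeleRing (𝓞 L) L)).preimage continuous_subtype_val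
  haveI : LocallyCompactSpace ↥(adelicUnipotent (↥(maximalRealSubfield L)) L (IsCMField.complexConj L) 3) := hNcl.locallyCompactSpace
  have hMfm : Measurable Mf := (measurable_borelConstantTerm ν 𝓕 hEm).sub hfm
  have hsle : MeasurableSet {g : (quasiSplit (↥(maximalRealSubfield L)) L (IsCMField.complexConj L) 3).Adelic | borelHeight g ≤ T} :=
    measurableSet_le continuous_borelHeight.measurable measurable_const
  have hslt : MeasurableSet {g : (quasiSplit (↥(maximalRealSubfield L)) L (IsCMField.complexConj L) 3).Adelic | T < borelHeight g} :=
    measurableSet_lt measurable_const continuous_borelHeight.measurable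
  have hf₁m : Measurable f₁ := hfm.indicator hsle
  have hf₂m : Measurable f₂ := hMfm.indicator hslt
  have hf₁N : ∀ (u : ↥(adelicUnipotent (↥(maximalRealSubfield L)) L (IsCMField.complexConj L) 3)) (g : (quasiSplit (↥(maximalRealSubfield L)) L (IsCMField.complexConj L) 3).Adelic),
      f₁ ((u : (quasiSplit (↥(maximalRealSubfield L)) L (IsCMField.complexConj L) 3).Adelic) * g) = f₁ g := fun u g => by
    simp only [hf₁, Set.indicator_apply, Set.mem_setOf_eq, borelHeight_unipotent_mul u.2, hfN u g]
  have hf₂N : ∀ (u : ↥(adelicUnipotent (↥(maximalRealSubfield L)) L (IsCMField.complexConj L) 3)) (g : (quasiSplit (↥(maximalRealSubfield L)) L (IsCMField.complexConj L) 3).Adelic),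
      f₂ ((u : (quasiSplit (↥(maximalRealSubfield L)) L (IsCMField.complexConj L) 3).Adelic) * g) = f₂ g := fun u g => by
    simp only [hf₂, Set.indicator_apply, Set.mem_setOf_eq, borelHeight_unipotent_mul u.2, hMfN u g]
  -- the lift `Λ = invQuot φ` of the cusp form (★ (β1))
  obtain ⟨hΛm, hΛinv, hΛq, hΛB⟩ := invQuot_package_of_mem_cuspForms 𝔓 i h𝔓 ν h𝓕N φ.2
  have hΛG : ∀ (γ : (quasiSplit (↥(maximalRealSubfield L)) L (IsCMField.complexConj L) 3).arithmeticSubgroup) (x : (quasiSplit (↥(maximalRealSubfield L)) L (IsCMField.complexConj L) 3).Adelic),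
      invQuot (quasiSplit (↥(maximalRealSubfield L)) L (IsCMField.complexConj L) 3) (φ : (quasiSplit (↥(maximalRealSubfield L)) L (IsCMField.complexConj L) 3).automorphicQuotient → ℂ)
        ((γ : (quasiSplit (↥(maximalRealSubfield L)) L (IsCMField.complexConj L) 3).Adelic) * x) =
      invQuot (quasiSplit (↥(maximalRealSubfield L)) L (IsCMField.complexConj L) 3) (φ : (quasiSplit (↥(maximalRealSubfield L)) L (IsCMField.complexConj L) 3).automorphicQuotient → ℂ) x :=
    fun γ x => hΛinv _ ((quasiSplit (↥(maximalRealSubfield L)) L (IsCMField.complexConj L) 3).arithmeticSubgroup_le_quotientSubgroup γ.2) x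
  have hq : ∀ x : (quasiSplit (↥(maximalRealSubfield L)) L (IsCMField.complexConj L) 3).automorphicQuotient,
      invQuot (quasiSplit (↥(maximalRealSubfield L)) L (IsCMField.complexConj L) 3) (φ : (quasiSplit (↥(maximalRealSubfield L)) L (IsCMField.complexConj L) 3).automorphicQuotient → ℂ)
        (Quotient.out (x : (quasiSplit (↥(maximalRealSubfield L)) L (IsCMField.complexConj L) 3).Adelic ⧸ (quasiSplit (↥(maximalRealSubfield L)) L (IsCMField.complexConj L) 3).quotientSubgroup))⁻¹ =
      (φ : (quasiSplit (↥(maximalRealSubfield L)) L (IsCMField.complexConj L) 3).automorphicQuotient → ℂ) x := fun x => congrFun hΛq x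
  have hφ2 : MemLp (φ : (quasiSplit (↥(maximalRealSubfield L)) L (IsCMField.complexConj L) 3).automorphicQuotient → ℂ) 2 μ := AdelicGroupData.memLp_of_mem_cuspForms φ.2
  have hφ1 : Integrable (φ : (quasiSplit (↥(maximalRealSubfield L)) L (IsCMField.complexConj L) 3).automorphicQuotient → ℂ) μ := hφ2.integrable one_le_two
  have hφ2' : ∫⁻ x, ‖(φ : (quasiSplit (↥(maximalRealSubfield L)) L (IsCMField.complexConj L) 3).automorphicQuotient → ℂ) x‖ₑ ^ (2 : ℝ) ∂μ < ∞ := by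
    have h := lintegral_rpow_enorm_lt_top_of_eLpNorm_lt_top (p := (2 : ℝ≥0∞)) (by norm_num) (by norm_num) hφ2.2
    simpa only [ENNReal.toReal_ofNat] using h
  -- the `L¹` letter for `f₂` (one coset above the floor): THE TAIL LETTER `hMbd`
  have hMfbd : ∀ g : (quasiSplit (↥(maximalRealSubfield L)) L (IsCMField.complexConj L) 3).Adelic, T < borelHeight g → ‖Mf g‖ ≤ max C 0 := fun g hg =>
    (hMbd g hg).trans (le_max_left _ _)
  have hL1₂ : ∫⁻ g, β g * ‖f₂ g * conj (invQuot (quasiSplit (↥(maximalRealSubfield L)) L (IsCMField.complexConj L) 3)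
      (φ : (quasiSplit (↥(maximalRealSubfield L)) L (IsCMField.complexConj L) 3).automorphicQuotient → ℂ) g)‖ₑ ∂haar < ∞ := by
    refine lintegral_weight_enorm_mul_lt_top_of_lintegral_quotient_lt_top μ haar hβ hf₂m hΛm hf₂B hΛG ?_
    calc ∫⁻ x : (quasiSplit (↥(maximalRealSubfield L)) L (IsCMField.complexConj L) 3).automorphicQuotient,
          (∑' q : Quotient (QuotientGroup.rightRel (arithmeticBorel (↥(maximalRealSubfield L)) L (IsCMField.complexConj L) 3)),
            ‖f₂ (((q.out : (quasiSplit (↥(maximalRealSubfield L)) L (IsCMField.complexConj L) 3).arithmeticSubgroup) : (quasiSplit (↥(maximalRealSubfield L)) L (IsCMField.complexConj L) 3).Adelic) *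
              (Quotient.out x : (quasiSplit (↥(maximalRealSubfield L)) L (IsCMField.complexConj L) 3).Adelic)⁻¹)‖ₑ) *
            ‖invQuot (quasiSplit (↥(maximalRealSubfield L)) L (IsCMField.complexConj L) 3) (φ : (quasiSplit (↥(maximalRealSubfield L)) L (IsCMField.complexConj L) 3).automorphicQuotient → ℂ)
              (Quotient.out x : (quasiSplit (↥(maximalRealSubfield L)) L (IsCMField.complexConj L) 3).Adelic)⁻¹‖ₑ ∂μ
        ≤ ∫⁻ x, ENNReal.ofReal (max C 0) * ‖(φ : (quasiSplit (↥(maximalRealSubfield L)) L (IsCMField.complexConj L) 3).automorphicQuotient → ℂ) x‖ₑ ∂μ :=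
          lintegral_mono fun x => by
            rw [hq x]
            exact mul_le_mul' (tsum_enorm_indicator_lt_le siegel_three hT (le_max_right _ _) hMfbd _) le_rfl
      _ < ∞ := by
          rw [lintegral_const_mul' _ _ ENNReal.ofReal_ne_top]
          exact ENNReal.mul_lt_top ENNReal.ofReal_lt_top hφ1.2
  -- the `L¹` letter for `f₁` (DOMINATION by the constant section `(M:ℂ)`, majorant through the real point, Hölder)
  obtain ⟨C₁, hC₁, hmaj⟩ := exists_tsum_enorm_lowIndicator_le_cm_three L ν h𝓕N h𝓕c ((M : ℝ) : ℂ) hT hz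
  have hdom : ∀ x : (quasiSplit (↥(maximalRealSubfield L)) L (IsCMField.complexConj L) 3).Adelic, ‖f₁ x‖ₑ ≤
      ‖({g : (quasiSplit (↥(maximalRealSubfield L)) L (IsCMField.complexConj L) 3).Adelic | borelHeight g ≤ T}.indicator (flatSectionU (fun _ : (quasiSplit (↥(maximalRealSubfield L)) L (IsCMField.complexConj L) 3).Adelic => ((M : ℝ) : ℂ)) z)) x‖ₑ := fun x => by
    by_cases hx : x ∈ {g : (quasiSplit (↥(maximalRealSubfield L)) L (IsCMField.complexConj L) 3).Adelic | borelHeight g ≤ T}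
    · rw [hf₁, Set.indicator_of_mem hx, Set.indicator_of_mem hx, hf, flatSectionU_apply, flatSectionU_apply, ← ofReal_norm, ← ofReal_norm, norm_mul, norm_mul]
      refine ENNReal.ofReal_le_ofReal (mul_le_mul_of_nonneg_right ?_ (norm_nonneg _))
      calc ‖φ₁ x‖ ≤ M := hφM x
        _ ≤ |M| := le_abs_self M
        _ = ‖((M : ℝ) : ℂ)‖ := by rw [Complex.norm_real, Real.norm_eq_abs]
    · rw [hf₁, Set.indicator_of_notMem hx, Set.indicator_of_notMem hx]
  have hL1₁ : ∫⁻ g, β g * ‖f₁ g * conj (invQuot (quasiSplit (↥(maximalRealSubfield L)) L (IsCMField.complexConj L) 3)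
      (φ : (quasiSplit (↥(maximalRealSubfield L)) L (IsCMField.complexConj L) 3).automorphicQuotient → ℂ) g)‖ₑ ∂haar < ∞ := by
    refine lintegral_weight_enorm_mul_lt_top_of_lintegral_quotient_lt_top μ haar hβ hf₁m hΛm hf₁B hΛG ?_
    have hum : AEMeasurable (fun x => ‖(quasiSplit (↥(maximalRealSubfield L)) L (IsCMField.complexConj L) 3).quotFun
        (truncation ν 𝓕 T (eisensteinSeriesU (flatSectionU (fun _ : (quasiSplit (↥(maximalRealSubfield L)) L (IsCMField.complexConj L) 3).Adelic => ((M : ℝ) : ℂ)) ((z.re : ℝ) : ℂ)))) x‖ₑ) μ :=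
      hL2.1.aemeasurable.enorm
    have hφm : AEMeasurable (fun x => ‖(φ : (quasiSplit (↥(maximalRealSubfield L)) L (IsCMField.complexConj L) 3).automorphicQuotient → ℂ) x‖ₑ) μ := hφ2.1.aemeasurable.enorm
    have hH := ENNReal.lintegral_mul_le_Lp_mul_Lq μ Real.HolderConjugate.two_two hum hφm
    have hfinH : ∫⁻ x, ‖(quasiSplit (↥(maximalRealSubfield L)) L (IsCMField.complexConj L) 3).quotFun
        (truncation ν 𝓕 T (eisensteinSeriesU (flatSectionU (fun _ : (quasiSplit (↥(maximalRealSubfield L)) L (IsCMField.complexConj L) 3).Adelic => ((M : ℝ) : ℂ)) ((z.re : ℝ) : ℂ)))) x‖ₑ *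
        ‖(φ : (quasiSplit (↥(maximalRealSubfield L)) L (IsCMField.complexConj L) 3).automorphicQuotient → ℂ) x‖ₑ ∂μ < ∞ := by
      refine lt_of_le_of_lt hH (ENNReal.mul_lt_top ?_ ?_)
      · refine ENNReal.rpow_lt_top_of_nonneg (by norm_num) (lt_top_iff_ne_top.1 ?_)
        have h := lintegral_rpow_enorm_lt_top_of_eLpNorm_lt_top (p := (2 : ℝ≥0∞)) (by norm_num) (by norm_num) hL2.2
        simpa only [ENNReal.toReal_ofNat] using h
      · exact ENNReal.rpow_lt_top_of_nonneg (by norm_num) (lt_top_iff_ne_top.1 hφ2')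
    calc ∫⁻ x : (quasiSplit (↥(maximalRealSubfield L)) L (IsCMField.complexConj L) 3).automorphicQuotient,
          (∑' q : Quotient (QuotientGroup.rightRel (arithmeticBorel (↥(maximalRealSubfield L)) L (IsCMField.complexConj L) 3)),
            ‖f₁ (((q.out : (quasiSplit (↥(maximalRealSubfield L)) L (IsCMField.complexConj L) 3).arithmeticSubgroup) : (quasiSplit (↥(maximalRealSubfield L)) L (IsCMField.complexConj L) 3).Adelic) *
              (Quotient.out x : (quasiSplit (↥(maximalRealSubfield L)) L (IsCMField.complexConj L) 3).Adelic)⁻¹)‖ₑ) *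
            ‖invQuot (quasiSplit (↥(maximalRealSubfield L)) L (IsCMField.complexConj L) 3) (φ : (quasiSplit (↥(maximalRealSubfield L)) L (IsCMField.complexConj L) 3).automorphicQuotient → ℂ)
              (Quotient.out x : (quasiSplit (↥(maximalRealSubfield L)) L (IsCMField.complexConj L) 3).Adelic)⁻¹‖ₑ ∂μ
        ≤ ∫⁻ x, (‖(quasiSplit (↥(maximalRealSubfield L)) L (IsCMField.complexConj L) 3).quotFun
              (truncation ν 𝓕 T (eisensteinSeriesU (flatSectionU (fun _ : (quasiSplit (↥(maximalRealSubfield L)) L (IsCMField.complexConj L) 3).Adelic => ((M : ℝ) : ℂ)) ((z.re : ℝ) : ℂ)))) x‖ₑ *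
              ‖(φ : (quasiSplit (↥(maximalRealSubfield L)) L (IsCMField.complexConj L) 3).automorphicQuotient → ℂ) x‖ₑ +
            C₁ * ‖(φ : (quasiSplit (↥(maximalRealSubfield L)) L (IsCMField.complexConj L) 3).automorphicQuotient → ℂ) x‖ₑ) ∂μ :=
          lintegral_mono fun x => by
            rw [hq x, ← add_mul]
            exact mul_le_mul' ((ENNReal.tsum_le_tsum fun q => hdom _).trans (hmaj _)) le_rfl
      _ < ∞ := by
          have hm2 : AEMeasurable (fun x => ‖(quasiSplit (↥(maximalRealSubfield L)) L (IsCMField.complexConj L) 3).quotFun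
              (truncation ν 𝓕 T (eisensteinSeriesU (flatSectionU (fun _ : (quasiSplit (↥(maximalRealSubfield L)) L (IsCMField.complexConj L) 3).Adelic => ((M : ℝ) : ℂ)) ((z.re : ℝ) : ℂ)))) x‖ₑ *
              ‖(φ : (quasiSplit (↥(maximalRealSubfield L)) L (IsCMField.complexConj L) 3).automorphicQuotient → ℂ) x‖ₑ) μ := hum.mul hφm
          rw [lintegral_add_left' hm2, lintegral_const_mul' _ _ hC₁.ne]
          exact ENNReal.add_lt_top.2 ⟨hfinH, ENNReal.mul_lt_top hC₁ hφ1.2⟩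
  -- ★ FILE A, twice
  obtain ⟨-, -, hint₁, -⟩ := integrable_and_integral_quotFun_eisensteinSeriesU_mul_conj_eq_three hc hc1 μ haar ν h𝓕N h𝓕₀ h𝓕top hβ hf₁m hΛm hf₁N hf₁B hΛG hL1₁
  obtain ⟨-, -, hint₂, -⟩ := integrable_and_integral_quotFun_eisensteinSeriesU_mul_conj_eq_three hc hc1 μ haar ν h𝓕N h𝓕₀ h𝓕top hβ hf₂m hΛm hf₂N hf₂B hΛG hL1₂
  have h0₁ := integral_quotFun_eisensteinSeriesU_mul_conj_eq_zero_three hc hc1 μ haar ν h𝓕N h𝓕₀ h𝓕top hβ hf₁m hΛm hf₁N hf₁B hΛG hL1₁ (ae_of_all _ hΛB)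
  have h0₂ := integral_quotFun_eisensteinSeriesU_mul_conj_eq_zero_three hc hc1 μ haar ν h𝓕N h𝓕₀ h𝓕top hβ hf₂m hΛm hf₂N hf₂B hΛG hL1₂ (ae_of_all _ hΛB)
  rw [hΛq] at hint₁ hint₂ h0₁ h0₂
  -- the split, pointwise (Godement majorant (iii′) at `(φ := φ₁) (M := M)`)
  have hsum : ∀ y : (quasiSplit (↥(maximalRealSubfield L)) L (IsCMField.complexConj L) 3).Adelic,
      Summable fun q : Quotient (orbitRel ↥(borelU ((IsCMField.complexConj L : L ≃ₐ[↥(maximalRealSubfield L)] L) : L →+* L) ((StdForm.antidiagonal 3).over L))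
        ↥(unitaryGroupOfForm ((IsCMField.complexConj L : L ≃ₐ[↥(maximalRealSubfield L)] L) : L →+* L) ((StdForm.antidiagonal 3).over L))) =>
        f ((quasiSplit (↥(maximalRealSubfield L)) L (IsCMField.complexConj L) 3).toAdelic (q.out : ↥(unitaryGroupOfForm ((IsCMField.complexConj L : L ≃ₐ[↥(maximalRealSubfield L)] L) : L →+* L) ((StdForm.antidiagonal 3).over L))) * y) :=
    fun y => (summable_eisensteinSeriesU_flatSectionU_cm_three L hz (φ := φ₁) (M := M) hφM y).of_norm
  have hsplit : ∀ x : (quasiSplit (↥(maximalRealSubfield L)) L (IsCMField.complexConj L) 3).automorphicQuotient,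
      (quasiSplit (↥(maximalRealSubfield L)) L (IsCMField.complexConj L) 3).quotFun (truncation ν 𝓕 T (eisensteinSeriesU f)) x =
        (quasiSplit (↥(maximalRealSubfield L)) L (IsCMField.complexConj L) 3).quotFun (eisensteinSeriesU f₁) x -
          (quasiSplit (↥(maximalRealSubfield L)) L (IsCMField.complexConj L) 3).quotFun (eisensteinSeriesU f₂) x := fun x =>
    truncation_eisensteinSeriesU_eq_three (ν := ν) (𝓕 := 𝓕) hT hfB hMfB hCT (hsum _)
  -- assemble
  rw [AdelicGroupData.cuspFormsToLp_apply, MeasureTheory.L2.inner_def]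
  have hae : (fun x : (quasiSplit (↥(maximalRealSubfield L)) L (IsCMField.complexConj L) 3).automorphicQuotient =>
      ⟪(hφ2.toLp (φ : (quasiSplit (↥(maximalRealSubfield L)) L (IsCMField.complexConj L) 3).automorphicQuotient → ℂ)) x, v x⟫_ℂ) =ᵐ[μ]
      fun x => (quasiSplit (↥(maximalRealSubfield L)) L (IsCMField.complexConj L) 3).quotFun (eisensteinSeriesU f₁) x *
          conj ((φ : (quasiSplit (↥(maximalRealSubfield L)) L (IsCMField.complexConj L) 3).automorphicQuotient → ℂ) x) -
        (quasiSplit (↥(maximalRealSubfield L)) L (IsCMField.complexConj L) 3).quotFun (eisensteinSeriesU f₂) x *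
          conj ((φ : (quasiSplit (↥(maximalRealSubfield L)) L (IsCMField.complexConj L) 3).automorphicQuotient → ℂ) x) := by
    filter_upwards [hφ2.coeFn_toLp, hv] with x hx hvx
    rw [hx, hvx, RCLike.inner_apply, hsplit x]
    ring
  rw [integral_congr_ae hae, integral_sub hint₁ hint₂, h0₁, h0₂, sub_zero]

end Level

/-! ## §2 THE χ-PAIR TUBE SEED, per point: `⟪φ̂, [Λ^T E(φ_ξ H^z)]⟫ = 0` for a `(χ₁, χ₂)`-pair section `φ_ξ` -/

section Pair
/-- **THE χ-PAIR TUBE SEED, PER POINT** (`U(2,1)_{L/L⁺}`): `φ_ξ` a CONTINUOUS BOUNDED `(χ₁, χ₂)`-pair section (★ `IsChiSectionPair χ₁ χ₂ φ_ξ`; `χ₂` automorphic, so `φ_ξ` is left-`N(𝔸)`- and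
left-`B(L⁺)`-invariant, ★ `.unipotent_mul` ∕ ★ `.toAdelic_mul`), `2 < Re z`, `T ≥ 1`, `v =ᵐ Λ^T E(φ_ξ H^z)` in `L²(μ)`: **`⟪φ̂, v⟫ = 0` for every cusp form `φ ∈ cuspForms μ 𝔓`** — §1, modulo the
tail letter `hMbd` ([MoeglinWaldspurger1995] II.1.7: `E_B(E f_z) − f_z = M(w,z)f_z`, bounded above the floor) and the spherical (Tr) letter `hL2`.
[cite: MoeglinWaldspurger1995, II.1.7–II.1.8, IV.1.11] [cite: Rogawski1990, §13.9 p. 229] [cite: BernsteinLapid2019, §4 Claim 2] -/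
theorem inner_cuspFormsToLp_eq_zero_of_ae_eq_truncation_pair_cm_three
    (ν : Measure ↥(adelicUnipotent (↥(maximalRealSubfield L)) L (IsCMField.complexConj L) 3)) [ν.IsHaarMeasure]
    {𝓕 : Set ↥(adelicUnipotent (↥(maximalRealSubfield L)) L (IsCMField.complexConj L) 3)}
    (h𝓕N : IsFundamentalDomain ↥(rationalUnipotent (↥(maximalRealSubfield L)) L (IsCMField.complexConj L) 3) 𝓕 ν) (h𝓕c : IsCompact (closure 𝓕))
    (𝔓 : (quasiSplit (↥(maximalRealSubfield L)) L (IsCMField.complexConj L) 3).ParabolicUnipotentData) (i : 𝔓.ι)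
    (h𝔓 : 𝔓.radical i = adelicUnipotent (↥(maximalRealSubfield L)) L (IsCMField.complexConj L) 3)
    {χ₁ : HeckeCharacter L} {χ₂ : ↥(TorusDict.torus (IsCMField.complexConj L)) →ₜ* ℂˣ} (hχ₂ : TorusDict.IsAutomorphic (IsCMField.complexConj L) χ₂)
    {φξ : (quasiSplit (↥(maximalRealSubfield L)) L (IsCMField.complexConj L) 3).Adelic → ℂ}
    (hφξ : IsChiSectionPair (F := ↥(maximalRealSubfield L)) χ₁ χ₂ φξ) (hφc : Continuous φξ) {M : ℝ} (hφM : ∀ x, ‖φξ x‖ ≤ M)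
    {T : ℝ≥0} (hT : 1 ≤ T) {z : ℂ} (hz : 2 < z.re)
    {C : ℝ} (hMbd : ∀ g : (quasiSplit (↥(maximalRealSubfield L)) L (IsCMField.complexConj L) 3).Adelic, T < borelHeight g →
      ‖borelConstantTerm ν 𝓕 (eisensteinSeriesU (flatSectionU φξ z)) g - flatSectionU φξ z g‖ ≤ C)
    (v : (quasiSplit (↥(maximalRealSubfield L)) L (IsCMField.complexConj L) 3).L2 μ)
    (hv : (v : (quasiSplit (↥(maximalRealSubfield L)) L (IsCMField.complexConj L) 3).automorphicQuotient → ℂ) =ᵐ[μ]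
      (quasiSplit (↥(maximalRealSubfield L)) L (IsCMField.complexConj L) 3).quotFun (truncation ν 𝓕 T (eisensteinSeriesU (flatSectionU φξ z))))
    (hL2 : MemLp ((quasiSplit (↥(maximalRealSubfield L)) L (IsCMField.complexConj L) 3).quotFun
      (truncation ν 𝓕 T (eisensteinSeriesU (flatSectionU (fun _ : (quasiSplit (↥(maximalRealSubfield L)) L (IsCMField.complexConj L) 3).Adelic => ((M : ℝ) : ℂ)) ((z.re : ℝ) : ℂ))))) 2 μ)
    (φ : ↥((quasiSplit (↥(maximalRealSubfield L)) L (IsCMField.complexConj L) 3).cuspForms μ 𝔓)) :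
    ⟪(quasiSplit (↥(maximalRealSubfield L)) L (IsCMField.complexConj L) 3).cuspFormsToLp μ 𝔓 φ, v⟫_ℂ = 0 :=
  inner_cuspFormsToLp_eq_zero_of_ae_eq_truncation_level_cm_three L μ ν h𝓕N h𝓕c 𝔓 i h𝔓 hφc hφM (fun u x => hφξ.unipotent_mul u x) (hφξ.toAdelic_mul hχ₂) hT hz hMbd v hv hL2 φ

end Pair

/-! ## §3 The letter (a) `hseed` of the (R)-road «of letters», token for token -/

section Seed
/-- **THE TUBE SEED IN THE (R)-ROAD'S SHAPE, LEVEL SECTION**: with `Ec z = E(φ₁H^z)` on `D ∩ {2 < re}` (the continuation agrees with the series on the tube), the operator road's family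
`Fam z =ᵐ Λ^T(Ec z)` on `D`, the TAIL LETTER `hMbd` at every tube point of `D` and the SPHERICAL (Tr) letter `hTr` at every real `σ > 2`: **`∀ z ∈ D, 2 < z.re → ∀ φ ∈ cuspForms μ 𝔓,
⟪cuspFormsToLp μ 𝔓 φ, Fam z⟫ = 0`** — the hypothesis `hseed` of ★ `inner_cuspFormsToLp_eq_zero_of_midResidue_letters` ∕ ★ `resGMidAtomGen_inner_cuspidal_eq_zero_of_letters` (§1 per point).
[cite: MoeglinWaldspurger1995, IV.1.11] [cite: BernsteinLapid2019, §4 Claim 2] -/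
theorem tubeSeed_level_cm_three_of_letters
    (ν : Measure ↥(adelicUnipotent (↥(maximalRealSubfield L)) L (IsCMField.complexConj L) 3)) [ν.IsHaarMeasure]
    {𝓕 : Set ↥(adelicUnipotent (↥(maximalRealSubfield L)) L (IsCMField.complexConj L) 3)}
    (h𝓕N : IsFundamentalDomain ↥(rationalUnipotent (↥(maximalRealSubfield L)) L (IsCMField.complexConj L) 3) 𝓕 ν) (h𝓕c : IsCompact (closure 𝓕))
    (𝔓 : (quasiSplit (↥(maximalRealSubfield L)) L (IsCMField.complexConj L) 3).ParabolicUnipotentData) (i : 𝔓.ι)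
    (h𝔓 : 𝔓.radical i = adelicUnipotent (↥(maximalRealSubfield L)) L (IsCMField.complexConj L) 3)
    {φ₁ : (quasiSplit (↥(maximalRealSubfield L)) L (IsCMField.complexConj L) 3).Adelic → ℂ} (hφc : Continuous φ₁) {M : ℝ} (hφM : ∀ x, ‖φ₁ x‖ ≤ M)
    (hφN : ∀ (u : ↥(adelicUnipotent (↥(maximalRealSubfield L)) L (IsCMField.complexConj L) 3)) (x : (quasiSplit (↥(maximalRealSubfield L)) L (IsCMField.complexConj L) 3).Adelic),
      φ₁ ((u : (quasiSplit (↥(maximalRealSubfield L)) L (IsCMField.complexConj L) 3).Adelic) * x) = φ₁ x)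
    (hφB : ∀ b ∈ borelU ((IsCMField.complexConj L : L ≃ₐ[↥(maximalRealSubfield L)] L) : L →+* L) ((StdForm.antidiagonal 3).over L),
      ∀ x : (quasiSplit (↥(maximalRealSubfield L)) L (IsCMField.complexConj L) 3).Adelic,
        φ₁ ((quasiSplit (↥(maximalRealSubfield L)) L (IsCMField.complexConj L) 3).toAdelic b * x) = φ₁ x)
    {T : ℝ≥0} (hT : 1 ≤ T)
    (Ec : ℂ → (quasiSplit (↥(maximalRealSubfield L)) L (IsCMField.complexConj L) 3).Adelic → ℂ) (D : Set ℂ)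
    (hE2 : ∀ z ∈ D, 2 < z.re → Ec z = eisensteinSeriesU (flatSectionU φ₁ z))
    (hMbd : ∀ z ∈ D, 2 < z.re → ∃ C : ℝ, ∀ g : (quasiSplit (↥(maximalRealSubfield L)) L (IsCMField.complexConj L) 3).Adelic, T < borelHeight g →
      ‖borelConstantTerm ν 𝓕 (eisensteinSeriesU (flatSectionU φ₁ z)) g - flatSectionU φ₁ z g‖ ≤ C)
    (hTr : ∀ σ : ℝ, 2 < σ → MemLp ((quasiSplit (↥(maximalRealSubfield L)) L (IsCMField.complexConj L) 3).quotFun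
      (truncation ν 𝓕 T (eisensteinSeriesU (flatSectionU (fun _ : (quasiSplit (↥(maximalRealSubfield L)) L (IsCMField.complexConj L) 3).Adelic => ((M : ℝ) : ℂ)) ((σ : ℝ) : ℂ))))) 2 μ)
    (Fam : ℂ → (quasiSplit (↥(maximalRealSubfield L)) L (IsCMField.complexConj L) 3).L2 μ)
    (hFam : ∀ z ∈ D, ((Fam z : (quasiSplit (↥(maximalRealSubfield L)) L (IsCMField.complexConj L) 3).L2 μ) : (quasiSplit (↥(maximalRealSubfield L)) L (IsCMField.complexConj L) 3).automorphicQuotient → ℂ) =ᵐ[μ]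
      (quasiSplit (↥(maximalRealSubfield L)) L (IsCMField.complexConj L) 3).quotFun (truncation ν 𝓕 T (Ec z))) :
    ∀ z ∈ D, 2 < z.re → ∀ φ : ↥((quasiSplit (↥(maximalRealSubfield L)) L (IsCMField.complexConj L) 3).cuspForms μ 𝔓),
      ⟪(quasiSplit (↥(maximalRealSubfield L)) L (IsCMField.complexConj L) 3).cuspFormsToLp μ 𝔓 φ, Fam z⟫_ℂ = 0 := by
  intro z hzD hz2 φ
  have hv := (hFam z hzD).trans (by rw [hE2 z hzD hz2])
  obtain ⟨C, hC⟩ := hMbd z hzD hz2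
  exact inner_cuspFormsToLp_eq_zero_of_ae_eq_truncation_level_cm_three L μ ν h𝓕N h𝓕c 𝔓 i h𝔓 hφc hφM hφN hφB hT hz2 hC (Fam z) hv (hTr z.re hz2) φ

/-- **THE χ-PAIR TUBE SEED IN THE (R)-ROAD'S SHAPE** — §3's head for a CONTINUOUS BOUNDED `(χ₁, χ₂)`-pair section `φ_ξ` (`χ₂` automorphic): **`∀ z ∈ D, 2 < z.re → ∀ φ,
⟪cuspFormsToLp μ 𝔓 φ, Fam z⟫ = 0`**, the letter (a) `hseed` of ★ `resGMidAtomGen_inner_cuspidal_eq_zero_of_letters` token for token, modulo `(Ec, hE2)`, `(Fam, hFam)`, the tail letter `hMbd`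
on the tube points of `D` and the spherical (Tr) letter `hTr`. [cite: MoeglinWaldspurger1995, II.1.7, IV.1.11] [cite: Rogawski1990, §13.9 p. 229] [cite: BernsteinLapid2019, §4 Claim 2] -/
theorem tubeSeed_pair_cm_three_of_letters
    (ν : Measure ↥(adelicUnipotent (↥(maximalRealSubfield L)) L (IsCMField.complexConj L) 3)) [ν.IsHaarMeasure]
    {𝓕 : Set ↥(adelicUnipotent (↥(maximalRealSubfield L)) L (IsCMField.complexConj L) 3)}
    (h𝓕N : IsFundamentalDomain ↥(rationalUnipotent (↥(maximalRealSubfield L)) L (IsCMField.complexConj L) 3) 𝓕 ν) (h𝓕c : IsCompact (closure 𝓕))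
    (𝔓 : (quasiSplit (↥(maximalRealSubfield L)) L (IsCMField.complexConj L) 3).ParabolicUnipotentData) (i : 𝔓.ι)
    (h𝔓 : 𝔓.radical i = adelicUnipotent (↥(maximalRealSubfield L)) L (IsCMField.complexConj L) 3)
    {χ₁ : HeckeCharacter L} {χ₂ : ↥(TorusDict.torus (IsCMField.complexConj L)) →ₜ* ℂˣ} (hχ₂ : TorusDict.IsAutomorphic (IsCMField.complexConj L) χ₂)
    {φξ : (quasiSplit (↥(maximalRealSubfield L)) L (IsCMField.complexConj L) 3).Adelic → ℂ}
    (hφξ : IsChiSectionPair (F := ↥(maximalRealSubfield L)) χ₁ χ₂ φξ) (hφc : Continuous φξ) {M : ℝ} (hφM : ∀ x, ‖φξ x‖ ≤ M)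
    {T : ℝ≥0} (hT : 1 ≤ T)
    (Ec : ℂ → (quasiSplit (↥(maximalRealSubfield L)) L (IsCMField.complexConj L) 3).Adelic → ℂ) (D : Set ℂ)
    (hE2 : ∀ z ∈ D, 2 < z.re → Ec z = eisensteinSeriesU (flatSectionU φξ z))
    (hMbd : ∀ z ∈ D, 2 < z.re → ∃ C : ℝ, ∀ g : (quasiSplit (↥(maximalRealSubfield L)) L (IsCMField.complexConj L) 3).Adelic, T < borelHeight g →
      ‖borelConstantTerm ν 𝓕 (eisensteinSeriesU (flatSectionU φξ z)) g - flatSectionU φξ z g‖ ≤ C)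
    (hTr : ∀ σ : ℝ, 2 < σ → MemLp ((quasiSplit (↥(maximalRealSubfield L)) L (IsCMField.complexConj L) 3).quotFun
      (truncation ν 𝓕 T (eisensteinSeriesU (flatSectionU (fun _ : (quasiSplit (↥(maximalRealSubfield L)) L (IsCMField.complexConj L) 3).Adelic => ((M : ℝ) : ℂ)) ((σ : ℝ) : ℂ))))) 2 μ)
    (Fam : ℂ → (quasiSplit (↥(maximalRealSubfield L)) L (IsCMField.complexConj L) 3).L2 μ)
    (hFam : ∀ z ∈ D, ((Fam z : (quasiSplit (↥(maximalRealSubfield L)) L (IsCMField.complexConj L) 3).L2 μ) : (quasiSplit (↥(maximalRealSubfield L)) L (IsCMField.complexConj L) 3).automorphicQuotient → ℂ) =ᵐ[μ]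
      (quasiSplit (↥(maximalRealSubfield L)) L (IsCMField.complexConj L) 3).quotFun (truncation ν 𝓕 T (Ec z))) :
    ∀ z ∈ D, 2 < z.re → ∀ φ : ↥((quasiSplit (↥(maximalRealSubfield L)) L (IsCMField.complexConj L) 3).cuspForms μ 𝔓),
      ⟪(quasiSplit (↥(maximalRealSubfield L)) L (IsCMField.complexConj L) 3).cuspFormsToLp μ 𝔓 φ, Fam z⟫_ℂ = 0 :=
  tubeSeed_level_cm_three_of_letters L μ ν h𝓕N h𝓕c 𝔓 i h𝔓 hφc hφM (fun u x => hφξ.unipotent_mul u x) (hφξ.toAdelic_mul hχ₂) hT Ec D hE2 hMbd hTr Fam hFam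

end Seed

end Summit.HodgeConjecture.HodgeConjecture.Cruxes.H413.K2E1ChiEisensteinPairTubeSeedCuspOrthogonalCMThree

end
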